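import Mathlib
import Literature.AlgebraicGeometry.Resolution.CobordantChartCoefficients

/-!
# Strong embedded resolution of plane curve germs: the count of non-normal-crossing infinitely near points

Classical theorem (every characteristic): the configuration of infinitely near points of a plane curve
singularity at which the reduced total transform under successive point blow-ups is not a normal crossing is
FINITE — equivalently, finitely many point blow-ups turn any reduced plane curve germ into a divisor with normal
crossings (strong embedded resolution).  Sources: Campillo, *Algebroid curves in positive characteristic*
(LNM 813), Ch. III (resolution of algebroid plane curves by quadratic transformations over an algebraically
closed field of any characteristic); Hartshorne, *Algebraic Geometry* V.3.9 (embedded resolution of curves in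
surfaces, any characteristic); Casas-Alvero, *Singularities of Plane Curves* §§3.7–3.8; Lipman, Ann. Math. 107
(1978) §2; Barth–Hulek–Peters–Van de Ven, *Compact Complex Surfaces*, III.7 (where this finiteness drives the
canonical resolution of double coverings).

This file records the theorem as a NAMED FACT in the CHART VOCABULARY of the tree's local resolution game
(`CobordantChart.chart`, Włodarczyk's cobordant chart with all weights `1` = the point blow-up seen at an
exceptional point; the coordinate slice `y_i' ↦ 0` of the `s`-saturated transform = the classical strict
transform in the affine chart, see `Summits/…/Theorems/WeightedInvariantLocalWeightedDropFaceDropPlane.lean` and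
the crux `LocalWeightedDrop` of route ResolutionOfSingularities/WeightedInvariant).  The packaging: a function
`ν : k[[y₀,y₁]] → ℕ` — the number of non-normal-crossing infinitely near points of the SUPPORT of `b` (the
reduced curve `b_red = 0`), origin included — with the three properties every user needs: (i) `ν b = 0` iff the
support is a normal crossing at the origin (`b∘Φ = u·y₀ᵃ·y₁ᶜ` in formal coordinates); (ii) monotone under
divisibility (inclusion of supports); (iii) strict drop at every point of the first blow-up, measured on the
reduced total transform germ `s·(strict transform)`.  (i)–(iii) are immediate from the definition of the count
and its finiteness; the finiteness is the theorem.

Deliberately NOT here: the theory of infinitely near points / proximity / multiplicity sequences itself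
(Campillo Ch. III, Casas-Alvero Ch. 3–4) — `-- TODO(general form)` below; and the unique factorisation of
`k[[y₀,y₁]]` that makes "support" literal (the statement avoids it by quantifying over all `b` and using
divisibility).
-/

namespace Literature.AlgebraicGeometry.Resolution

/-- **Named fact (strong embedded resolution of plane curve germs, chart form).**  Over an algebraically
closed field `k` (any characteristic) there is `ν : k[[y₀,y₁]] → ℕ` — the number of infinitely near points of the
origin, origin included, at which the reduced total transform of the curve `b = 0` under the chain of point
blow-ups is not a normal crossing — such that for non-zero `b`:
(i) `ν b = 0` iff `b∘Φ = u·y₀ᵃ·y₁ᶜ` for some formal coordinate change `Φ`, unit `u`, `a c : ℕ` (the support of `b`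
is empty, one smooth branch, or two transversal smooth branches);
(ii) `b ∣ d ≠ 0 → ν b ≤ ν d`;
(iii) if the support of `b` is not a normal crossing then at every exceptional point `c ≠ 0` of the point blow-up
(`b(s(c + y')) = sᵃ·G`, `s ∤ G`) some slot `i` with `cᵢ ≠ 0` has `ν (s · G|_{y_i' = 0}) < ν b` (the reduced total
transform at that point has fewer non-normal-crossing infinitely near points).
Finiteness of `ν` is the EMBEDDED RESOLUTION OF CURVES IN SURFACES: Hartshorne, *Algebraic Geometry*, Thm. V.3.9
(over an algebraically closed field of any characteristic: blowing up the non-nodal points of the reduced total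
inverse image terminates, since every singularity other than a node forces `p_a` to drop); for formal (algebroid)
germs directly: Campillo, LNM 813 (Hamburger–Noether expansions, any characteristic), and Casas-Alvero,
*Singularities of Plane Curves*, Thm. 3.7.1, Cor. 3.7.7, Lemma 3.8.1 (a reduced germ has finitely many singular
— multiple, satellite, or non-transversal-to-`E` — infinitely near points).
[cite: Hartshorne1977, Thm. V.3.9]
-- TODO(general form): the statement for a curve on an arbitrary regular surface / the whole resolution
-- configuration (proximity matrix, multiplicity sequence) as a finite combinatorial invariant; here only the
-- count of non-normal-crossing infinitely near points of a FORMAL plane germ and its three working properties,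
-- in the chart vocabulary of the local resolution game, are recorded. -/
def PlaneGermNonNCCount (k : Type*) [Field k] : Prop :=
    ∃ ν : MvPowerSeries (Fin 2) k → ℕ,
      (∀ b : MvPowerSeries (Fin 2) k, b ≠ 0 → (ν b = 0 ↔
        (∃ (Φ : Fin 2 → MvPowerSeries (Fin 2) k) (u : MvPowerSeries (Fin 2) k) (a c : ℕ),
          (∀ i, MvPowerSeries.constantCoeff (Φ i) = 0) ∧
          IsUnit (Matrix.det (Matrix.of fun i j => MvPowerSeries.coeff (Finsupp.single j 1) (Φ i))) ∧
          MvPowerSeries.constantCoeff u ≠ 0 ∧ MvPowerSeries.subst Φ b = u * MvPowerSeries.X 0 ^ a * MvPowerSeries.X 1 ^ c))) ∧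
      (∀ b d : MvPowerSeries (Fin 2) k, d ≠ 0 → b ∣ d → ν b ≤ ν d) ∧
      (∀ b : MvPowerSeries (Fin 2) k, b ≠ 0 →
        ¬ (∃ (Φ : Fin 2 → MvPowerSeries (Fin 2) k) (u : MvPowerSeries (Fin 2) k) (a c : ℕ),
          (∀ i, MvPowerSeries.constantCoeff (Φ i) = 0) ∧
          IsUnit (Matrix.det (Matrix.of fun i j => MvPowerSeries.coeff (Finsupp.single j 1) (Φ i))) ∧
          MvPowerSeries.constantCoeff u ≠ 0 ∧ MvPowerSeries.subst Φ b = u * MvPowerSeries.X 0 ^ a * MvPowerSeries.X 1 ^ c) →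
        ∀ c : Fin 2 → k, c ≠ 0 → ∀ (a : ℕ) (G : MvPowerSeries (Fin 3) k),
          MvPowerSeries.subst (CobordantChart.chart (fun _ : Fin 2 => 1) c) b = MvPowerSeries.X 0 ^ a * G →
          ¬ (MvPowerSeries.X (0 : Fin 3) ∣ G) →
          ∃ i : Fin 2, c i ≠ 0 ∧
            ν (MvPowerSeries.X 0 * MvPowerSeries.subst (fun j : Fin 3 => if j = i.succ then (0 : MvPowerSeries (Fin 2) k)
                  else MvPowerSeries.X (Fin.predAbove i j)) G) < ν b)

end Literature.AlgebraicGeometry.Resolution
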